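import Literature.NumberTheory.EllipticCurves.HeegnerPointsOfConductorRationalityBirch
import Literature.NumberTheory.EllipticCurves.HeegnerPointsOfConductorPrimeLevelProofs
import HarnessLib

/-!
# Discharge of `phi_heegnerPointOfConductor_mem_range_map_ringClassField_birch`
# (Heegner points of conductor `n` are rational over `K[n]` under BIRCH's condition `4N ∣ β² − d_K`)

Topic `NumberTheory/EllipticCurves` (complex multiplication on `X₀(N)`); namespace
`Literature.NumberTheory.EllipticCurves`. Theorems only (no definition, no new named fact; net
Literature debt `−1`).

The named fact `phi_heegnerPointOfConductor_mem_range_map_ringClassField_birch N W K`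
(`HeegnerPointsOfConductorRationalityBirch.lean`; Darmon 2004 Thm. 3.6 at `τ = x(n)`, Gross 1984 §I.3,
Gross 1991 §3) records: for `E/ℚ` elliptic with model `W`, `K` imaginary quadratic, a parametrisation
datum `Dt` at level `N`, an orientation `β` with `4N ∣ β² − d_K` (Birch's Heegner condition — primes
dividing both `N` and `d_K` allowed), `ι : K → ℂ` and `n ≠ 0` prime to `N`, the complex point
`y(n) = φ(x(n))` is the image under `K[n] ⊂ ℂ` of a point of `E(K[n])`. Its docstring says "not provable
in the tree today"; since then the tree's primitive level-transport engine
(`HeegnerPointsOfConductorPrimeLevelProofs.lean`: `levelTransport_self_of_apply_formJ_eq_of_primitive`,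
ARM-P cited-input audit) proved `phi_heegnerPointOfConductor_mem_range_map_ringClassField_of_ne_zero` —
the SAME conclusion for every `n ≠ 0` from `IsImaginaryQuadratic K` and `4N ∣ β² − d_K` ALONE (no Heegner
hypothesis, no coprimality). The Birch-keyed fact is therefore a theorem: this file records the one-line
specialisation.

* `phi_heegnerPointOfConductor_mem_range_map_ringClassField_birch_holds` — the named fact HOLDS.

Consumer: crux `AdditiveBranchIMC.GordTwoRankZeroOffCaseOne` / `MultLower` / `GordTwoRankOne` of summit
`BirchSwinnertonDyer` (three-field road; the fact is conjunct 14 of the printed-facts hypothesis list of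
`ThreeFieldRowClosed.missingLowerBoundAt_rankZero_of_threeFieldRow`), where one named hypothesis becomes a
theorem. HONEST FRAMING: classical CM rationality only; nothing about `L`-functions or BSD.

## References
* [Darmon2004] H. Darmon, *Rational Points on Modular Elliptic Curves*, CBMS 101 (2004), Thm. 3.5, Thm. 3.6
  (PDF pp. 42–44).
* [Gross1984] B. H. Gross, *Heegner points on `X₀(N)`* (1984), §I.3.
* [GrossLMS1991] B. H. Gross, *Kolyvagin's work on modular elliptic curves* (1991), §3 (p. 238).

## Tree search
`lean search 'phi_heegnerPointOfConductor_mem_range_map_ringClassField'`: the fact (…RationalityBirch),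
the split-keyed sibling and its discharge `…_holds` (…RationalityProofs), the hypothesis-free engine theorem
`…_of_ne_zero` (…PrimeLevelProofs); no prior `…_birch_holds`.
-/

universe u

namespace Literature.NumberTheory.EllipticCurves

variable (N : ℕ) [NeZero N] (W : WeierstrassCurve ℚ) (K : Type u) [Field K] [NumberField K]

/-- **The named fact `phi_heegnerPointOfConductor_mem_range_map_ringClassField_birch` HOLDS** (Darmon
2004 Thm. 3.6 at `τ = x(n)` under Birch's condition `4N ∣ β² − d_K`: `Φ_N(x(n)) ∈ E(K[n])`): the
specialisation of `phi_heegnerPointOfConductor_mem_range_map_ringClassField_of_ne_zero` (which needs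
neither the Heegner hypothesis nor `gcd(n, N) = 1`; the coprimality binder of the fact is idle).
[cite: Darmon2004, Thm. 3.6 with Thm. 3.5 (PDF pp. 42–44)] [cite: GrossLMS1991, §3 (p. 238)] -/
theorem phi_heegnerPointOfConductor_mem_range_map_ringClassField_birch_holds :
    phi_heegnerPointOfConductor_mem_range_map_ringClassField_birch N W K :=
  fun hK Dt β ι n hβ hn _ =>
    phi_heegnerPointOfConductor_mem_range_map_ringClassField_of_ne_zero N W K hK Dt β ι n hβ hn

/-- Universe-`0` packaging in the shape the consumers quantify (`∀ N [NeZero N] W (K : Type) …`): the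
Birch-keyed rationality fact holds for every level, model and imaginary quadratic field.
[cite: Darmon2004, Thm. 3.6 (PDF pp. 43–44)] -/
theorem forall_phi_heegnerPointOfConductor_mem_range_map_ringClassField_birch :
    ∀ (N : ℕ) [NeZero N] (W : WeierstrassCurve ℚ) (K : Type) [Field K] [NumberField K],
      phi_heegnerPointOfConductor_mem_range_map_ringClassField_birch N W K :=
  fun N _ W K _ _ => phi_heegnerPointOfConductor_mem_range_map_ringClassField_birch_holds N W K

end Literature.NumberTheory.EllipticCurves
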